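import Summits.NavierStokesRegularity.FluidComputer.LevelReynoldsFloor
import Literature.Analysis.FluidPDE.NSCriticalClosureBesovProofs
import Literature.Analysis.FluidPDE.MollifiedSliceTools
import Literature.Analysis.FluidPDE.LittlewoodPaleyBlockFn
import Literature.Analysis.FunctionSpaces.LittlewoodPaleyBernsteinProofs

/-!
# Fluid computer — L2″: the RATIO form of the level-Reynolds floor (idea-1 gen 5 sketch, pub-fluidc)

HONEST FRAMING (cell `pub-fluidc`, verbatim): *low prior, high value-of-information experiment on Tao's
machine paradigm; NOT a claim that NS blows up.* Theorem side of the cell; nothing here is evidence of blow-up. (Provenance: idea-1 gen 5/6, staged `HOME/pub-fluidc-idea-1/lean/LevelRatioFloor.lean` sha16 `fae7538b63c2d73c`; filed verbatim by pub-fluidc-lit gen 35 on idea-1's ASK 2026-08-23T02:26Z.)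

`LevelReynoldsFloor.level_amplitude_frequently_gt` (L2) says: along the dyadic levels `j` of a maximal smooth
solution with finite lifespan `T`, the level weights `S j := sup_{t ∈ (0,T)} 2^{-j} ‖Δ̇_j u(t)‖_∞` exceed `b ν`
at infinitely many levels (every `b < c`).  This file turns that into the CONSTANT-FREE statement the amplitude
rung actually tabulates (`r = g/λ` per level, SCHEMA.md 9.21): **for every `a < 1` the successive level ratio
`S (j+1) / S j` exceeds `a` at infinitely many levels** (`level_ratio_frequently_gt`), provided each `S j` is
finite (hypothesis `hfin`; for a Leray–Hopf solution it follows from Bernstein's inequality and the energy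
bound, `‖Δ̇_j u(t)‖_∞ ≲ 2^{3j/2} ‖u 0‖_2` — left to the caller).  Reading: a machine cannot keep its per-level
Reynolds ratio `≤ a < 1` from some level on; and NOTHING is asserted at any fixed finite set of levels — which is
exactly why a level-1 or level-2 measurement of `r` (the R2 instrument, depth ≤ 6 octaves) never decides the
floor either way (HOME/pub-fluidc-idea-1/TRANSIENT-GAP.md §1).

Contents: `frequently_ratio_gt_of_frequently_ge` (real sequences), `ennreal_frequently_ratio_gt` (the `ℝ≥0∞`
transfer), `level_ratio_frequently_gt` (L2″ in the tree's vocabulary, with the finiteness hypothesis), `not_eventually_level_contraction`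
(corollary), `level_weight_ne_top` (the finiteness hypothesis DISCHARGED for Leray–Hopf solutions: Bernstein `L² → L^∞` on blocks,
uniform `L²`-boundedness of the blocks, the energy bound `‖u(t)‖₂ ≤ ‖u(0)‖₂`), `level_ratio_frequently_gt'` (L2″ hypothesis-free), `level_weight_le_energy` (the a-priori CEILING
`S j ≤ C 2^{j/2} ‖u 0‖₂`), and the COMPOUND forms `frequently_step_ratio_gt_of_frequently_ge` / `ennreal_frequently_step_ratio_gt` /
`level_compound_ratio_frequently_gt` (L2‴: for every depth `m ≥ 1` and `a < 1`, `a · S j < S (j+m)` infinitely often), and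
`compound_from_top_frequently_ge` (the `ρ_D` form: `(c ν) S 0 ≤ (C ‖u 0‖₂) S j` infinitely often), and
`block_concentration_frequently` (the INTERMITTENCY floor: block sup/L² ratio `≥ (c/C) 2^j / Re` at infinitely many
levels — blow-up is all coherence, carried by tubes).
-/

noncomputable section

open MeasureTheory Set Function Filter Topology TemperedDistribution
open scoped ENNReal NNReal SchwartzMap
open Literature.Analysis.FluidPDE Literature.Analysis.FunctionSpaces

namespace Summit.NavierStokesRegularity.FluidComputer.LevelRatioFloor

/-- A real sequence that is frequently `≥ c > 0` has successive ratio frequently above every `a ∈ [0,1)`: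
`∃ᶠ j, a * P j < P (j+1)` (no sign hypothesis on `P`). -/
theorem frequently_ratio_gt_of_frequently_ge {P : ℕ → ℝ}
    {c : ℝ} (hc : 0 < c) (hfreq : ∃ᶠ j in atTop, c ≤ P j) {a : ℝ} (ha0 : 0 ≤ a) (ha1 : a < 1) :
    ∃ᶠ j in atTop, a * P j < P (j + 1) := by
  by_contra h
  rw [Filter.not_frequently] at h
  simp only [not_lt] at h
  obtain ⟨J, hJ⟩ := Filter.eventually_atTop.1 h
  have key : ∀ n, P (J + n) ≤ a ^ n * P J := by
    intro n
    induction n with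
    | zero => simp
    | succ n ih =>
      have hstep : P (J + n + 1) ≤ a * P (J + n) := hJ (J + n) (Nat.le_add_right J n)
      calc P (J + (n + 1)) = P (J + n + 1) := by rw [Nat.add_succ]
        _ ≤ a * P (J + n) := hstep
        _ ≤ a * (a ^ n * P J) := mul_le_mul_of_nonneg_left ih ha0
        _ = a ^ (n + 1) * P J := by ring
  have tend : Tendsto (fun n : ℕ => a ^ n * P J) atTop (nhds 0) := by
    have h0 := tendsto_pow_atTop_nhds_zero_of_lt_one ha0 ha1
    simpa using h0.mul_const (P J)
  have ev : ∀ᶠ n : ℕ in atTop, a ^ n * P J < c := tend.eventually (gt_mem_nhds hc)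
  obtain ⟨N, hN⟩ := Filter.eventually_atTop.1 ev
  obtain ⟨j, hcj, hj⟩ := (hfreq.and_eventually (Filter.eventually_ge_atTop (J + N))).exists
  have hjJ : J ≤ j := le_trans (Nat.le_add_right J N) hj
  have hn : N ≤ j - J := by omega
  have hPj : P j ≤ a ^ (j - J) * P J := by
    have := key (j - J)
    rwa [Nat.add_sub_cancel' hjJ] at this
  have : P j < c := lt_of_le_of_lt hPj (hN (j - J) hn)
  exact absurd hcj (not_le.mpr this)

/-- The `ℝ≥0∞` transfer: a sequence of FINITE extended non-negative reals frequently above `ofReal c`, `c > 0`,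
has successive ratio frequently above every `a < 1`. -/
theorem ennreal_frequently_ratio_gt {S : ℕ → ℝ≥0∞} {c : ℝ} (hc : 0 < c)
    (hfreq : ∃ᶠ j in atTop, ENNReal.ofReal c < S j) (hfin : ∀ j, S j ≠ ∞)
    {a : ℝ≥0∞} (ha1 : a < 1) :
    ∃ᶠ j in atTop, a * S j < S (j + 1) := by
  have ha_top : a ≠ ∞ := ne_top_of_lt ha1
  have hfreqR : ∃ᶠ j in atTop, c ≤ (S j).toReal := by
    refine hfreq.mono fun j hj => ?_
    exact ((ENNReal.ofReal_lt_iff_lt_toReal hc.le (hfin j)).1 hj).le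
  have ha0R : 0 ≤ a.toReal := ENNReal.toReal_nonneg
  have ha1R : a.toReal < 1 := by
    have := (ENNReal.toReal_lt_toReal ha_top ENNReal.one_ne_top).2 ha1
    simpa using this
  have h := frequently_ratio_gt_of_frequently_ge (P := fun j => (S j).toReal) hc hfreqR ha0R ha1R
  refine h.mono fun j hj => ?_
  have hlt : (a * S j).toReal < (S (j + 1)).toReal := by
    rw [ENNReal.toReal_mul]; exact hj
  exact (ENNReal.toReal_lt_toReal (ENNReal.mul_ne_top ha_top (hfin j)) (hfin (j + 1))).1 hlt

/-- **L2″ — the ratio form of the level-Reynolds floor (constant-free).** For every maximal smooth solution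
`(u, p)` of the unforced system with finite lifespan `T`, Leray–Hopf from `u 0`, with slice distributions `U t`,
whose level weights `S j := sup_{t ∈ (0,T)} lpBlockWeight (-1) ∞ (U t) j = sup_t 2^{-j} ‖Δ̇_j U(t)‖_∞` are finite
at every level, and for every `a < 1`: at INFINITELY MANY dyadic levels `j` the next level carries more than
`a` times the weight of level `j`, `a · S j < S (j+1)` — i.e. the per-level Reynolds ratio `r_j = S (j+1) / S j`
of the amplitude rung is NOT eventually `≤ a`.  From L2 with `b = c/2` and `ennreal_frequently_ratio_gt`.
[cite: CheskidovShvydkoy2010, Lemma 3.2] -/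
theorem level_ratio_frequently_gt :
    ∀ (ν T : ℝ), 0 < ν → 0 < T → ∀ (u : ℝ → EuclideanSpace ℝ (Fin 3) → EuclideanSpace ℝ (Fin 3))
      (p : ℝ → EuclideanSpace ℝ (Fin 3) → ℝ)
      (U : ℝ → 𝓢'(EuclideanSpace ℝ (Fin 3), EuclideanSpace ℂ (Fin 3))),
      IsMaximalSmoothSolution ν 0 u p T → IsLerayHopfOn T ν 0 (u 0) u →
      (∀ t ∈ Icc 0 T, IsDistributionOf (u t) (U t)) →
      (∀ j : ℕ, (⨆ t ∈ Ioo 0 T, lpBlockWeight (-1) ∞ (U t) (j : ℤ)) ≠ ∞) →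
      ∀ a : ℝ≥0∞, a < 1 →
        ∃ᶠ j : ℕ in atTop,
          a * (⨆ t ∈ Ioo 0 T, lpBlockWeight (-1) ∞ (U t) (j : ℤ)) <
            ⨆ t ∈ Ioo 0 T, lpBlockWeight (-1) ∞ (U t) ((j + 1 : ℕ) : ℤ) := by
  intro ν T hν hT u p U hmax hLH hU hfin a ha
  obtain ⟨c, hc, H⟩ := LevelReynoldsFloor.level_amplitude_frequently_gt
  have hb : c / 2 < c := by linarith
  have hfreq := H ν T hν hT u p U hmax hLH hU (c / 2) hb
  have hc2 : 0 < c / 2 * ν := mul_pos (by linarith) hν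
  exact ennreal_frequently_ratio_gt (S := fun j : ℕ => ⨆ t ∈ Ioo 0 T, lpBlockWeight (-1) ∞ (U t) (j : ℤ))
    hc2 hfreq hfin ha

/-- **Corollary — no eventual level contraction.** Under the hypotheses of `level_ratio_frequently_gt` there is
no factor `a < 1` such that `S (j+1) ≤ a · S j` for all large `j`: the would-be machine's level amplitudes cannot
contract geometrically faster than the scale ratio from some level on (the `r_floor = 1` line of SCHEMA.md 9.21(c),
read as a statement about the TAIL of the level sequence, never about its first levels). -/
theorem not_eventually_level_contraction :
    ∀ (ν T : ℝ), 0 < ν → 0 < T → ∀ (u : ℝ → EuclideanSpace ℝ (Fin 3) → EuclideanSpace ℝ (Fin 3))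
      (p : ℝ → EuclideanSpace ℝ (Fin 3) → ℝ)
      (U : ℝ → 𝓢'(EuclideanSpace ℝ (Fin 3), EuclideanSpace ℂ (Fin 3))),
      IsMaximalSmoothSolution ν 0 u p T → IsLerayHopfOn T ν 0 (u 0) u →
      (∀ t ∈ Icc 0 T, IsDistributionOf (u t) (U t)) →
      (∀ j : ℕ, (⨆ t ∈ Ioo 0 T, lpBlockWeight (-1) ∞ (U t) (j : ℤ)) ≠ ∞) →
      ∀ a : ℝ≥0∞, a < 1 →
        ¬ ∀ᶠ j : ℕ in atTop,
          (⨆ t ∈ Ioo 0 T, lpBlockWeight (-1) ∞ (U t) ((j + 1 : ℕ) : ℤ)) ≤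
            a * ⨆ t ∈ Ioo 0 T, lpBlockWeight (-1) ∞ (U t) (j : ℤ) := by
  intro ν T hν hT u p U hmax hLH hU hfin a ha hev
  have h := level_ratio_frequently_gt ν T hν hT u p U hmax hLH hU hfin a ha
  exact (h.and_eventually hev).exists.elim fun j hj => (not_le.mpr hj.1) hj.2

/-- **Finiteness of the level weights of a Leray–Hopf solution** (discharges `hfin`): for an unforced Leray–Hopf
solution on `[0, T]` from `u 0` with slice distributions `U t`, every level weight
`S j = sup_{t ∈ (0,T)} 2^{-j} ‖Δ̇_j U(t)‖_∞` is finite — Bernstein on the block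
(`exists_eLpNormDistrib_lpBlock_le 2 ∞`: `‖Δ̇_j v‖_∞ ≤ C₁ 2^{3j/2} ‖Δ̇_j v‖_2`), uniform `L²`-boundedness of the blocks
(`exists_eLpNormDistrib_lpBlock_le_eLpNormDistrib 2`), `‖U(t)‖_{L²} = ‖u(t)‖_{L²}` (`IsDistributionOf.eLpNormDistrib_eq`) and the
energy bound `‖u(t)‖₂ ≤ ‖u(0)‖₂` (`IsLerayHopfOn.eLpNorm_le_eLpNorm_datum`). [folklore] -/
theorem level_weight_ne_top {ν T : ℝ} (hν : 0 < ν) (hT : 0 < T)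
    {u : ℝ → EuclideanSpace ℝ (Fin 3) → EuclideanSpace ℝ (Fin 3)}
    {U : ℝ → 𝓢'(EuclideanSpace ℝ (Fin 3), EuclideanSpace ℂ (Fin 3))}
    (hLH : IsLerayHopfOn T ν 0 (u 0) u) (hU : ∀ t ∈ Icc 0 T, IsDistributionOf (u t) (U t)) (j : ℕ) :
    (⨆ t ∈ Ioo 0 T, lpBlockWeight (-1) ∞ (U t) (j : ℤ)) ≠ ∞ := by
  have h0 : MemLp (u 0) 2 volume := hLH.memLp 0 ⟨le_rfl, hT.le⟩
  have hE : ∀ t ∈ Ioo 0 T, eLpNormDistrib 2 (U t) ≤ eLpNorm (u 0) 2 volume := fun t ht => by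
    have ht' : t ∈ Icc 0 T := Ioo_subset_Icc_self ht
    rw [(hU t ht').eLpNormDistrib_eq (hLH.memLp t ht')]
    exact hLH.eLpNorm_le_eLpNorm_datum hν.le h0 ht'
  obtain ⟨C₁, -, hB⟩ := exists_eLpNormDistrib_lpBlock_le
    (E := EuclideanSpace ℝ (Fin 3)) (F := EuclideanSpace ℂ (Fin 3)) 2 ∞ le_top
  obtain ⟨C₂, hC₂⟩ := exists_eLpNormDistrib_lpBlock_le_eLpNormDistrib
    (E := EuclideanSpace ℝ (Fin 3)) (F := EuclideanSpace ℂ (Fin 3)) 2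
  have key : ∀ t ∈ Ioo 0 T, lpBlockWeight (-1) ∞ (U t) (j : ℤ) ≤
      (2 : ℝ≥0∞) ^ (((j : ℤ) : ℝ) * (-1 : ℝ)) *
        (C₁ * (2 : ℝ≥0∞) ^ (((j : ℤ) : ℝ) * Module.finrank ℝ (EuclideanSpace ℝ (Fin 3)) *
            ((2 : ℝ≥0∞).toReal⁻¹ - (∞ : ℝ≥0∞).toReal⁻¹)) * (C₂ * eLpNorm (u 0) 2 volume)) := by
    intro t ht
    simp only [lpBlockWeight]
    refine mul_le_mul_right ?_ _
    exact (hB (j : ℤ) (U t)).trans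
      (mul_le_mul_right ((hC₂ (j : ℤ) (U t)).trans (mul_le_mul_right (hE t ht) _)) _)
  have h2 : ∀ y : ℝ, (2 : ℝ≥0∞) ^ y ≠ ∞ := fun y => by
    rw [Ne, ENNReal.rpow_eq_top_iff]; norm_num
  refine ne_top_of_le_ne_top ?_ (iSup₂_le key)
  exact ENNReal.mul_ne_top (h2 _) (ENNReal.mul_ne_top (ENNReal.mul_ne_top ENNReal.coe_ne_top (h2 _))
    (ENNReal.mul_ne_top ENNReal.coe_ne_top h0.eLpNorm_ne_top))

/-- **L2″, hypothesis-free** — the ratio form of the level-Reynolds floor with the finiteness of the level weights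
discharged by `level_weight_ne_top`: for every maximal smooth solution `(u, p)` with finite lifespan `T`, Leray–Hopf
from `u 0`, slice distributions `U t`, and every `a < 1`, at infinitely many dyadic levels `j`,
`a · S j < S (j+1)` where `S j = ⨆ t ∈ (0,T), lpBlockWeight (-1) ∞ (U t) j`. [cite: CheskidovShvydkoy2010, Lemma 3.2] -/
theorem level_ratio_frequently_gt' :
    ∀ (ν T : ℝ), 0 < ν → 0 < T → ∀ (u : ℝ → EuclideanSpace ℝ (Fin 3) → EuclideanSpace ℝ (Fin 3))
      (p : ℝ → EuclideanSpace ℝ (Fin 3) → ℝ)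
      (U : ℝ → 𝓢'(EuclideanSpace ℝ (Fin 3), EuclideanSpace ℂ (Fin 3))),
      IsMaximalSmoothSolution ν 0 u p T → IsLerayHopfOn T ν 0 (u 0) u →
      (∀ t ∈ Icc 0 T, IsDistributionOf (u t) (U t)) →
      ∀ a : ℝ≥0∞, a < 1 →
        ∃ᶠ j : ℕ in atTop,
          a * (⨆ t ∈ Ioo 0 T, lpBlockWeight (-1) ∞ (U t) (j : ℤ)) <
            ⨆ t ∈ Ioo 0 T, lpBlockWeight (-1) ∞ (U t) ((j + 1 : ℕ) : ℤ) :=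
  fun ν T hν hT u p U hmax hLH hU a ha =>
    level_ratio_frequently_gt ν T hν hT u p U hmax hLH hU (level_weight_ne_top hν hT hLH hU) a ha

/-- **Energy ceiling of the level weights** (the a-priori upper envelope matching the floor): there is an absolute
constant `C` such that for every unforced Leray–Hopf solution on `[0, T]` from `u 0` with slice distributions `U t` and
every level `j`, `S j = sup_{t ∈ (0,T)} 2^{-j} ‖Δ̇_j U(t)‖_∞ ≤ C · 2^{j/2} · ‖u 0‖_{L²}` (Bernstein `L² → L^∞` costs
`2^{3j/2}`, the weight `2^{-j}`, and `‖Δ̇_j U(t)‖₂ ≤ C₂ ‖u(t)‖₂ ≤ C₂ ‖u 0‖₂`). With L1/L2 this brackets the level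
weights of a blow-up: `c ν < S j ≤ C 2^{j/2} ‖u 0‖₂` at infinitely many `j`. [folklore] -/
theorem level_weight_le_energy : ∃ C : ℝ≥0, ∀ (ν T : ℝ), 0 < ν → 0 < T →
    ∀ (u : ℝ → EuclideanSpace ℝ (Fin 3) → EuclideanSpace ℝ (Fin 3))
      (U : ℝ → 𝓢'(EuclideanSpace ℝ (Fin 3), EuclideanSpace ℂ (Fin 3))),
      IsLerayHopfOn T ν 0 (u 0) u → (∀ t ∈ Icc 0 T, IsDistributionOf (u t) (U t)) →
      ∀ j : ℕ, (⨆ t ∈ Ioo 0 T, lpBlockWeight (-1) ∞ (U t) (j : ℤ)) ≤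
        C * (2 : ℝ≥0∞) ^ ((j : ℝ) / 2) * eLpNorm (u 0) 2 volume := by
  obtain ⟨C₁, -, hB⟩ := exists_eLpNormDistrib_lpBlock_le
    (E := EuclideanSpace ℝ (Fin 3)) (F := EuclideanSpace ℂ (Fin 3)) 2 ∞ le_top
  obtain ⟨C₂, hC₂⟩ := exists_eLpNormDistrib_lpBlock_le_eLpNormDistrib
    (E := EuclideanSpace ℝ (Fin 3)) (F := EuclideanSpace ℂ (Fin 3)) 2
  refine ⟨C₁ * C₂, fun ν T hν hT u U hLH hU j => ?_⟩
  have h0 : MemLp (u 0) 2 volume := hLH.memLp 0 ⟨le_rfl, hT.le⟩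
  have hE : ∀ t ∈ Ioo 0 T, eLpNormDistrib 2 (U t) ≤ eLpNorm (u 0) 2 volume := fun t ht => by
    have ht' : t ∈ Icc 0 T := Ioo_subset_Icc_self ht
    rw [(hU t ht').eLpNormDistrib_eq (hLH.memLp t ht')]
    exact hLH.eLpNorm_le_eLpNorm_datum hν.le h0 ht'
  have hexp : ((j : ℤ) : ℝ) * Module.finrank ℝ (EuclideanSpace ℝ (Fin 3)) *
      ((2 : ℝ≥0∞).toReal⁻¹ - (∞ : ℝ≥0∞).toReal⁻¹) = 3 * (j : ℝ) / 2 := by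
    simp; ring
  have hpow : (2 : ℝ≥0∞) ^ (((j : ℤ) : ℝ) * (-1 : ℝ)) * (2 : ℝ≥0∞) ^ (3 * (j : ℝ) / 2) =
      (2 : ℝ≥0∞) ^ ((j : ℝ) / 2) := by
    rw [← ENNReal.rpow_add _ _ (by norm_num) (by norm_num)]
    congr 1; push_cast; ring
  refine iSup₂_le fun t ht => ?_
  simp only [lpBlockWeight]
  calc (2 : ℝ≥0∞) ^ (((j : ℤ) : ℝ) * (-1 : ℝ)) * eLpNormDistrib ∞ (lpBlock (j : ℤ) (U t))
      ≤ (2 : ℝ≥0∞) ^ (((j : ℤ) : ℝ) * (-1 : ℝ)) *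
          (C₁ * (2 : ℝ≥0∞) ^ (3 * (j : ℝ) / 2) * (C₂ * eLpNorm (u 0) 2 volume)) := by
        refine mul_le_mul_right ?_ _
        have hb := hB (j : ℤ) (U t)
        rw [hexp] at hb
        exact hb.trans (mul_le_mul_right ((hC₂ (j : ℤ) (U t)).trans (mul_le_mul_right (hE t ht) _)) _)
    _ = ((C₁ * C₂ : ℝ≥0) : ℝ≥0∞) * (2 : ℝ≥0∞) ^ ((j : ℝ) / 2) * eLpNorm (u 0) 2 volume := by
        rw [← hpow]; push_cast; ring

/-- **m-step (compound) version for real sequences**: a sequence frequently `≥ c > 0` satisfies, for every depth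
`m ≥ 1` and every `a ∈ [0,1)`, `a * P j < P (j + m)` at infinitely many `j` (apply the one-step lemma to the block
maxima `Q k = max_{i<m} P (k m + i)`). -/
theorem frequently_step_ratio_gt_of_frequently_ge {P : ℕ → ℝ}
    {c : ℝ} (hc : 0 < c) (hfreq : ∃ᶠ j in atTop, c ≤ P j) {a : ℝ} (ha0 : 0 ≤ a) (ha1 : a < 1)
    {m : ℕ} (hm : 0 < m) :
    ∃ᶠ j in atTop, a * P j < P (j + m) := by
  have hne : (Finset.range m).Nonempty := Finset.nonempty_range_iff.2 hm.ne'
  set Q : ℕ → ℝ := fun k => (Finset.range m).sup' hne (fun i => P (k * m + i)) with hQ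
  have hPQ : ∀ k i, i < m → P (k * m + i) ≤ Q k := fun k i hi =>
    Finset.le_sup' (fun i => P (k * m + i)) (Finset.mem_range.2 hi)
  have hfreqQ : ∃ᶠ k in atTop, c ≤ Q k := by
    rw [Filter.frequently_atTop] at hfreq ⊢
    intro K
    obtain ⟨j, hj, hcj⟩ := hfreq (K * m)
    refine ⟨j / m, (Nat.le_div_iff_mul_le hm).2 hj, ?_⟩
    have hsplit : j / m * m + j % m = j := Nat.div_add_mod' j m
    calc c ≤ P j := hcj
      _ = P (j / m * m + j % m) := by rw [hsplit]
      _ ≤ Q (j / m) := hPQ _ _ (Nat.mod_lt j hm)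
  have h1 := frequently_ratio_gt_of_frequently_ge hc hfreqQ ha0 ha1
  rw [Filter.frequently_atTop] at h1 ⊢
  intro N
  obtain ⟨k, hk, hlt⟩ := h1 N
  obtain ⟨i, hi, hQi⟩ := Finset.exists_mem_eq_sup' hne (fun i => P ((k + 1) * m + i))
  have him : i < m := Finset.mem_range.1 hi
  refine ⟨k * m + i, ?_, ?_⟩
  · exact le_trans hk (le_trans (Nat.le_mul_of_pos_right k hm) (Nat.le_add_right _ _))
  · have hidx : k * m + i + m = (k + 1) * m + i := by ring
    calc a * P (k * m + i) ≤ a * Q k := mul_le_mul_of_nonneg_left (hPQ k i him) ha0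
      _ < Q (k + 1) := hlt
      _ = P ((k + 1) * m + i) := hQi
      _ = P (k * m + i + m) := by rw [hidx]
/-- The `ℝ≥0∞` transfer, m-step version. -/
theorem ennreal_frequently_step_ratio_gt {S : ℕ → ℝ≥0∞} {c : ℝ} (hc : 0 < c)
    (hfreq : ∃ᶠ j in atTop, ENNReal.ofReal c < S j) (hfin : ∀ j, S j ≠ ∞)
    {a : ℝ≥0∞} (ha1 : a < 1) {m : ℕ} (hm : 0 < m) :
    ∃ᶠ j in atTop, a * S j < S (j + m) := by
  have ha_top : a ≠ ∞ := ne_top_of_lt ha1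
  have hfreqR : ∃ᶠ j in atTop, c ≤ (S j).toReal := by
    refine hfreq.mono fun j hj => ?_
    exact ((ENNReal.ofReal_lt_iff_lt_toReal hc.le (hfin j)).1 hj).le
  have ha0R : 0 ≤ a.toReal := ENNReal.toReal_nonneg
  have ha1R : a.toReal < 1 := by
    have := (ENNReal.toReal_lt_toReal ha_top ENNReal.one_ne_top).2 ha1
    simpa using this
  have h := frequently_step_ratio_gt_of_frequently_ge (P := fun j => (S j).toReal) hc hfreqR ha0R ha1R hm
  refine h.mono fun j hj => ?_
  have hlt : (a * S j).toReal < (S (j + m)).toReal := by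
    rw [ENNReal.toReal_mul]; exact hj
  exact (ENNReal.toReal_lt_toReal (ENNReal.mul_ne_top ha_top (hfin j)) (hfin (j + m))).1 hlt
/-- **L2‴ — the COMPOUND-ratio form of the floor, hypothesis-free.** For every maximal smooth solution with finite
lifespan (as in L2), every depth `m ≥ 1` and every `a < 1`: at infinitely many levels `j`,
`a · S j < S (j + m)`.  With `a = b^m` this says the compound m-level ratio `S (j+m) / S j = Π_{k<m} r_{j+k}`
exceeds `b^m` infinitely often for every `b < 1`: the floor constrains the compound ratio over EVERY fixed depth
exactly as it constrains single steps (which is why the rung's two-level chain should be read through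
`C₂ = r₁ r₂` against `b²`, never through `r₂` alone — HOME/pub-fluidc-idea-1/TRANSIENT-GAP.md §1).
[cite: CheskidovShvydkoy2010, Lemma 3.2] -/
theorem level_compound_ratio_frequently_gt :
    ∀ (ν T : ℝ), 0 < ν → 0 < T → ∀ (u : ℝ → EuclideanSpace ℝ (Fin 3) → EuclideanSpace ℝ (Fin 3))
      (p : ℝ → EuclideanSpace ℝ (Fin 3) → ℝ)
      (U : ℝ → 𝓢'(EuclideanSpace ℝ (Fin 3), EuclideanSpace ℂ (Fin 3))),
      IsMaximalSmoothSolution ν 0 u p T → IsLerayHopfOn T ν 0 (u 0) u →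
      (∀ t ∈ Icc 0 T, IsDistributionOf (u t) (U t)) →
      ∀ m : ℕ, 0 < m → ∀ a : ℝ≥0∞, a < 1 →
        ∃ᶠ j : ℕ in atTop,
          a * (⨆ t ∈ Ioo 0 T, lpBlockWeight (-1) ∞ (U t) (j : ℤ)) <
            ⨆ t ∈ Ioo 0 T, lpBlockWeight (-1) ∞ (U t) ((j + m : ℕ) : ℤ) := by
  intro ν T hν hT u p U hmax hLH hU m hm a ha
  obtain ⟨c, hc, H⟩ := LevelReynoldsFloor.level_amplitude_frequently_gt
  have hb : c / 2 < c := by linarith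
  have hfreq := H ν T hν hT u p U hmax hLH hU (c / 2) hb
  have hc2 : 0 < c / 2 * ν := mul_pos (by linarith) hν
  exact ennreal_frequently_step_ratio_gt (S := fun j : ℕ => ⨆ t ∈ Ioo 0 T, lpBlockWeight (-1) ∞ (U t) (j : ℤ))
    hc2 hfreq (level_weight_ne_top hν hT hLH hU) ha hm
/-- **Compound ratio from the top (the `ρ_D` form of the floor).** There are absolute constants `c > 0` and `C`
such that for every maximal smooth solution with finite lifespan (as in L2): at infinitely many levels `j`,
`(c ν) · S 0 ≤ (C ‖u 0‖_{L²}) · S j` — i.e. the compound ratio from level `0` down to level `j`,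
`S j / S 0 = Π_{k<j} r_k`, is at least `c ν / (C ‖u 0‖₂)` (an inverse Reynolds number) infinitely often, so the
geometric-mean ratio over the first `j` levels, `ρ_j = (S j / S 0)^{1/j}`, satisfies `limsup ρ_j ≥ 1` however large
the Reynolds number (floor L2 at level `j` × ceiling `level_weight_le_energy` at level `0`). This is the statement
behind reading the rung's depth-`D` tables through `ρ_D` (HOME/pub-fluidc-idea-1/TRANSIENT-GAP.md §1).
[cite: CheskidovShvydkoy2010, Lemma 3.2] -/
theorem compound_from_top_frequently_ge : ∃ (c : ℝ) (C : ℝ≥0), 0 < c ∧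
    ∀ (ν T : ℝ), 0 < ν → 0 < T → ∀ (u : ℝ → EuclideanSpace ℝ (Fin 3) → EuclideanSpace ℝ (Fin 3))
      (p : ℝ → EuclideanSpace ℝ (Fin 3) → ℝ)
      (U : ℝ → 𝓢'(EuclideanSpace ℝ (Fin 3), EuclideanSpace ℂ (Fin 3))),
      IsMaximalSmoothSolution ν 0 u p T → IsLerayHopfOn T ν 0 (u 0) u →
      (∀ t ∈ Icc 0 T, IsDistributionOf (u t) (U t)) →
        ∃ᶠ j : ℕ in atTop,
          ENNReal.ofReal (c * ν) * (⨆ t ∈ Ioo 0 T, lpBlockWeight (-1) ∞ (U t) ((0 : ℕ) : ℤ)) ≤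
            (C * eLpNorm (u 0) 2 volume) * ⨆ t ∈ Ioo 0 T, lpBlockWeight (-1) ∞ (U t) (j : ℤ) := by
  obtain ⟨c, hc, H⟩ := LevelReynoldsFloor.level_amplitude_frequently_gt
  obtain ⟨C, hC⟩ := level_weight_le_energy
  refine ⟨c / 2, C, by linarith, fun ν T hν hT u p U hmax hLH hU => ?_⟩
  have hb : c / 2 < c := by linarith
  have hfreq := H ν T hν hT u p U hmax hLH hU (c / 2) hb
  have h0 : (⨆ t ∈ Ioo 0 T, lpBlockWeight (-1) ∞ (U t) ((0 : ℕ) : ℤ)) ≤ C * eLpNorm (u 0) 2 volume := by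
    have := hC ν T hν hT u U hLH hU 0
    simpa using this
  refine hfreq.mono fun j hj => ?_
  calc ENNReal.ofReal (c / 2 * ν) * (⨆ t ∈ Ioo 0 T, lpBlockWeight (-1) ∞ (U t) ((0 : ℕ) : ℤ))
      ≤ (⨆ t ∈ Ioo 0 T, lpBlockWeight (-1) ∞ (U t) (j : ℤ)) * (C * eLpNorm (u 0) 2 volume) :=
        mul_le_mul' hj.le h0
    _ = (C * eLpNorm (u 0) 2 volume) * ⨆ t ∈ Ioo 0 T, lpBlockWeight (-1) ∞ (U t) (j : ℤ) := mul_comm _ _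
/-- **Intermittency floor (blow-up is all coherence).** There are absolute constants `c > 0`, `C` such that for every
maximal smooth solution with finite lifespan `T` (Leray–Hopf from `u 0`, slice distributions `U t`): at infinitely
many levels `j` there is a time `t ∈ (0,T)` at which the dyadic block is CONCENTRATED,
`(c ν) · 2^j · ‖Δ̇_j U(t)‖_{L²} ≤ (C ‖u 0‖_{L²}) · ‖Δ̇_j U(t)‖_{L^∞}`, i.e. the block's sup/L² ratio is at least
`(c/C) · 2^j / Re` with `Re = ‖u 0‖₂/ν` (floor L2 at `(j,t)` × the uniform block energy bound
`‖Δ̇_j U(t)‖₂ ≤ C₂ ‖u(t)‖₂ ≤ C₂ ‖u 0‖₂`).  Since `sup/L² ≲ |supp|^{-1/2}`, the block energy must then sit in a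
volume `≲ (C/c)² Re² 4^{-j}` — a bounded number of TUBES of width `2^{-j}`, never sheets — and since the rms side
cannot grow (energy), the per-level amplitude ratio `r ≥ 1` of a machine is ENTIRELY a growth of coherence
(sup/rms by a factor `≥ 2` per level eventually, in the cell's units `Dc → λ / rms₁`).  This is the theorem behind
the gen-5 reading 'the optimisers only ever moved the coherence factor, and a machine needs it to grow by λ per
level for ever' (HOME/pub-fluidc-idea-1/PREREG-R2-READING.md §7g). [cite: CheskidovShvydkoy2010, Lemma 3.2] -/
theorem block_concentration_frequently : ∃ (c : ℝ) (C : ℝ≥0), 0 < c ∧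
    ∀ (ν T : ℝ), 0 < ν → 0 < T → ∀ (u : ℝ → EuclideanSpace ℝ (Fin 3) → EuclideanSpace ℝ (Fin 3))
      (p : ℝ → EuclideanSpace ℝ (Fin 3) → ℝ)
      (U : ℝ → 𝓢'(EuclideanSpace ℝ (Fin 3), EuclideanSpace ℂ (Fin 3))),
      IsMaximalSmoothSolution ν 0 u p T → IsLerayHopfOn T ν 0 (u 0) u →
      (∀ t ∈ Icc 0 T, IsDistributionOf (u t) (U t)) →
        ∃ᶠ j : ℕ in atTop, ∃ t ∈ Ioo 0 T,
          ENNReal.ofReal (c * ν) * (2 : ℝ≥0∞) ^ (j : ℝ) * eLpNormDistrib 2 (lpBlock (j : ℤ) (U t)) ≤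
            C * eLpNorm (u 0) 2 volume * eLpNormDistrib ∞ (lpBlock (j : ℤ) (U t)) := by
  obtain ⟨c, hc, H⟩ := LevelReynoldsFloor.level_amplitude_frequently_gt
  obtain ⟨C₂, hC₂⟩ := exists_eLpNormDistrib_lpBlock_le_eLpNormDistrib
    (E := EuclideanSpace ℝ (Fin 3)) (F := EuclideanSpace ℂ (Fin 3)) 2
  refine ⟨c / 2, C₂, by linarith, fun ν T hν hT u p U hmax hLH hU => ?_⟩
  have hb : c / 2 < c := by linarith
  have hfreq := H ν T hν hT u p U hmax hLH hU (c / 2) hb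
  have h0 : MemLp (u 0) 2 volume := hLH.memLp 0 ⟨le_rfl, hT.le⟩
  have hE : ∀ t ∈ Ioo 0 T, eLpNormDistrib 2 (U t) ≤ eLpNorm (u 0) 2 volume := fun t ht => by
    have ht' : t ∈ Icc 0 T := Ioo_subset_Icc_self ht
    rw [(hU t ht').eLpNormDistrib_eq (hLH.memLp t ht')]
    exact hLH.eLpNorm_le_eLpNorm_datum hν.le h0 ht'
  refine hfreq.mono fun j hj => ?_
  rw [lt_iSup_iff] at hj
  obtain ⟨t, hjt⟩ := hj
  rw [lt_iSup_iff] at hjt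
  obtain ⟨ht, hlt⟩ := hjt
  refine ⟨t, ht, ?_⟩
  simp only [lpBlockWeight] at hlt
  have h2j : (2 : ℝ≥0∞) ^ (j : ℝ) * (2 : ℝ≥0∞) ^ (((j : ℤ) : ℝ) * (-1 : ℝ)) = 1 := by
    rw [← ENNReal.rpow_add _ _ (by norm_num) (by norm_num)]
    have : (j : ℝ) + ((j : ℤ) : ℝ) * (-1 : ℝ) = 0 := by push_cast; ring
    rw [this, ENNReal.rpow_zero]
  have hsup : ENNReal.ofReal (c / 2 * ν) * (2 : ℝ≥0∞) ^ (j : ℝ) ≤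
      eLpNormDistrib ∞ (lpBlock (j : ℤ) (U t)) :=
    calc ENNReal.ofReal (c / 2 * ν) * (2 : ℝ≥0∞) ^ (j : ℝ)
        ≤ (2 : ℝ≥0∞) ^ (((j : ℤ) : ℝ) * (-1 : ℝ)) * eLpNormDistrib ∞ (lpBlock (j : ℤ) (U t)) *
            (2 : ℝ≥0∞) ^ (j : ℝ) := mul_le_mul' hlt.le le_rfl
      _ = (2 : ℝ≥0∞) ^ (j : ℝ) *
            ((2 : ℝ≥0∞) ^ (((j : ℤ) : ℝ) * (-1 : ℝ)) * eLpNormDistrib ∞ (lpBlock (j : ℤ) (U t))) :=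
          mul_comm _ _
      _ = (2 : ℝ≥0∞) ^ (j : ℝ) * (2 : ℝ≥0∞) ^ (((j : ℤ) : ℝ) * (-1 : ℝ)) *
            eLpNormDistrib ∞ (lpBlock (j : ℤ) (U t)) := (mul_assoc _ _ _).symm
      _ = eLpNormDistrib ∞ (lpBlock (j : ℤ) (U t)) := by rw [h2j, one_mul]
  have hL2 : eLpNormDistrib 2 (lpBlock (j : ℤ) (U t)) ≤ C₂ * eLpNorm (u 0) 2 volume :=
    (hC₂ (j : ℤ) (U t)).trans (mul_le_mul' le_rfl (hE t ht))
  calc ENNReal.ofReal (c / 2 * ν) * (2 : ℝ≥0∞) ^ (j : ℝ) * eLpNormDistrib 2 (lpBlock (j : ℤ) (U t))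
      ≤ eLpNormDistrib ∞ (lpBlock (j : ℤ) (U t)) * (C₂ * eLpNorm (u 0) 2 volume) := mul_le_mul' hsup hL2
    _ = C₂ * eLpNorm (u 0) 2 volume * eLpNormDistrib ∞ (lpBlock (j : ℤ) (U t)) := mul_comm _ _

end Summit.NavierStokesRegularity.FluidComputer.LevelRatioFloor

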